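import Summits.QuantumFields.YangMills.Theorems.BalabanUVNodesN15PerCubeGreenNodeAdjoint
import Summits.QuantumFields.YangMills.Theorems.BalabanUVNodesN15TraceFormCoordinates
import Summits.QuantumFields.YangMills.Theorems.BalabanUVNodesN15CovariantLandauOnePropagatorKnitClosedInstance
import HarnessLib

/-!
# N15 = NE2, road (c) — PROGRAMME (PC), (PC-E-K-N): A CLOSED INSTANCE OF THE NODE — `T4EtaRate.NE2PlusOperator` AND `NE2ZeroOperator` FOR THE NAMED SCALAR COVARIANT GREEN's
# FUNCTION FAMILY WITH ALL FOUR ENTRIES OF (3.42), at `d + 1 = 4`, `L = 7`, colour `𝔲(2)` in the trace-form coordinates, King's mass `a₀ = 1`, class letters `c₃₅ = c₄r = β₀ = 1`,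
# directions `μ₀ ν` — NO hypotheses (the referee's non-vacuity check (A2) as a kernel theorem) (dag-n15-c g38, n15-c∕437)

Cell `pub-ymgap`, seat `pub-ymgap-dag-n15-c` (generation g38; R134 (a), s1; HUMAN RULING D-0062; chair R424 venue).  `bears_on: R4∕N15 · K3⁸ SpineGivenEndpointR13SepCoPHV
(stmt-QuantumFields-27366)`; filed `--kind proof --supports stmt-QuantumFields-27366 --as helper` — COUNT-NEUTRAL.  Two theorems, 0 `def`, 0 `sorry`.  Imports BY NAME n15-c∕436
`…PerCubeGreenNodeAdjoint` (★★★★ `ne2PlusOperator_pc`, `ne2ZeroOperator_pc`), dag-n15-c `…N15TraceFormCoordinates` (`tfCoords`, `traceForm_eq_tfCoords_dotProduct`: the standing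
hypothesis `he` DISCHARGED for `e := tfCoords (Fin 2)`) and n15-c∕259 `…CovariantLandauOnePropagatorKnitClosedInstance` (`SiteLayerSf.odd_seven_and_one_lt`, reused, not restated).  Nothing in the tree is modified, no landed name re-declared.

WHY.  n15-c∕436's ★★★★ `ne2PlusOperator_pc` carries the hypotheses `Odd L ∧ 1 < L`, `7 ≤ L`, `0 < a₀`, `0 < c₃₅`, `0 ≤ c₄r`, `0 < β₀` and trace-form-orthonormal coordinates `e` of
`𝔲(m)`; this file shows they are jointly satisfiable by exhibiting ONE closed instance — four Euclidean dimensions (`d = 3`), block size `L = 7`, `2 × 2` complex matrices in the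
coordinates `tfCoords (Fin 2) : M₂(ℂ) ≃L[ℝ] (Fin 2 × Fin 2 × Fin 2 → ℝ)`, every real letter `1` — so that the statement `NE2PlusOperator 1 (pcInstance …) (pcFamily₂ …)` with all four
entries of [B9] (3.42) constructed is a hypothesis-free theorem at that index family (its guard `M₅ ≤ L^m` LIVE inside).

HONEST FRAMING ∕ LIMITS.  Instantiation only; MODEL family (King's doubled-torus cover, one cube scale `ξ = 1`, straight-holonomy pairing, class constants tied to `M = L^m`); the
class is dag-n07-a's typed `Reg910Cube` per cube as a HYPOTHESIS on the configuration inside `NE2PlusOperator`'s quantifier block; the SHAPE of [B9] Thm 3.1∕3.14 for `G′`, NOT the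
printed theorems; nothing of [B9]∕[B11] asserted.  NE2⁺ NOT PRINTED ∕ NOT proved as printed; N15 of record untouched (DISCHARGED AS CONSUMED, p687738; U-blind pin); K3⁸ OPEN; counts
of record UNMOVED (typed 28∕28 · discharged 8∕27); one finite 𝕋⁴ at fixed ε per index — NOT infinite volume, NOT OS on ℝ⁴, NOT a mass gap, NOT Clay.  Restate-immune (no Theses import).
-/

set_option autoImplicit false

noncomputable section

namespace Summit.QuantumFields.YangMills.BalabanUVNodes.N15.Gluing

open Literature.MathematicalPhysics.QuantumFieldTheory.Balaban1983to89.T4EtaRate (NE2PlusOperator NE2ZeroOperator)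
open Summit.QuantumFields.YangMills.BalabanUVNodes.N15.TraceFormCoords (tfCoords traceForm_eq_tfCoords_dotProduct)

/-- ★ **A CLOSED INSTANCE OF NE2⁺ (OPERATOR LAYER) WITH ALL FOUR ENTRIES OF (3.42)**: `d = 3`, `L = 7`, `𝔲(2)` in the trace-form coordinates, `a₀ = c₃₅ = c₄r = β₀ = 1`, any
directions `μ₀ ν` — no hypotheses. [cite: Balaban1985BackgroundPropagators, Thm 3.1 p.397 (quantifier template, (3.42) entries 0–3); King1986, Prop. 3.9 (3.73) p.665 (rate factor)] -/
theorem ne2PlusOperator_pc_instance (μ₀ ν : Fin (3 + 1)) :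
    NE2PlusOperator 1 (pcInstance 3 (Fin 2) (Fin 2 × Fin 2 × Fin 2) 1 1 SiteLayerSf.odd_seven_and_one_lt)
      (fun i => pcFamily₂ 3 (Fin 2) (Fin 2 × Fin 2 × Fin 2) 1 (tfCoords (Fin 2)) 1 1 SiteLayerSf.odd_seven_and_one_lt i μ₀ ν) :=
  ne2PlusOperator_pc 3 (Fin 2) (Fin 2 × Fin 2 × Fin 2) (tfCoords (Fin 2)) SiteLayerSf.odd_seven_and_one_lt le_rfl one_pos one_pos zero_le_one one_pos
    (traceForm_eq_tfCoords_dotProduct (Fin 2)) μ₀ ν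

/-- ★ **A CLOSED INSTANCE OF NE2⁰ (OPERATOR LAYER)** at the same data — no hypotheses. [cite: King1986, Props. 3.8–3.9 (3.71)–(3.75) pp.664–665 (A = 0 model)] -/
theorem ne2ZeroOperator_pc_instance (μ₀ ν : Fin (3 + 1)) :
    NE2ZeroOperator (pcInstance 3 (Fin 2) (Fin 2 × Fin 2 × Fin 2) 1 1 SiteLayerSf.odd_seven_and_one_lt)
      (fun i => pcFamily₂ 3 (Fin 2) (Fin 2 × Fin 2 × Fin 2) 1 (tfCoords (Fin 2)) 1 1 SiteLayerSf.odd_seven_and_one_lt i μ₀ ν) :=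
  ne2ZeroOperator_pc 3 (Fin 2) (Fin 2 × Fin 2 × Fin 2) (tfCoords (Fin 2)) SiteLayerSf.odd_seven_and_one_lt le_rfl one_pos one_pos one_pos one_pos
    (traceForm_eq_tfCoords_dotProduct (Fin 2)) μ₀ ν

end Summit.QuantumFields.YangMills.BalabanUVNodes.N15.Gluing

end
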